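import Literature.Probability.Percolation.ParaPivotalArms
import Literature.Probability.Percolation.TriAnnulusCircuit
import HarnessLib

/-!
# Positivity of the arm probabilities: `n₀(j) = 0` for `j ≤ 6` (Nolin 2008, §4.1)

Topic `Literature/Probability/Percolation`; family `crit-perc` (site percolation `P_{1/2}` on the
triangular lattice `𝕋`). PROOFS ONLY (two auxiliary geometric definitions, no named fact).

P. Nolin, *Near-critical percolation in two dimensions*, EJP 13 (2008), §4.1 [arXiv 0711.4948,
p. 8]: "if `j` is too large compared to `n`, the event `A_{j,σ}(n,N)` can be void, just because the
arms do not have enough space on `∂S_n` to arrive all together … we just have to check that `n` is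
large enough so that the number of sites touching the exterior of `∂S_n` … is at least `j`: if this
is true, we can then draw straight lines heading toward the exterior. For each positive integer
`j`, we thus introduce `n₀(j)` the least such nonnegative integer, and we have
`∀ N ≥ n₀(j), A_{j,σ}(n₀(j),N) ≠ ∅`. Note that `n₀(j) = 0` for `j = 1, …, 6`."

For the hexagonal annuli `Λ_R ∖ Λ_r` of this library's `armEvent κ r R` (`ArmEvents.lean`: `k`
pairwise vertex-disjoint monochromatic self-avoiding arms from `∂Λ_r` to `∂Λ_R`, `Λ_n = triBall n`)
the six "straight lines" are the lattice rays `t ↦ t • u_d`, `u_0, …, u_5` the six unit vectors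
of `𝕋`; they leave `∂Λ_r` at six distinct sites as soon as `r ≥ 1` (for `r = 0` two arms would
share the origin, cf. `polyArmProb_twoArm_pos`). Prescribing the colours of the `k (R - r + 1)`
ray sites is a cylinder event of positive `P_{1/2}`-probability, whence:

* `polyArmProb_pos` — **for every `k ≤ 6`, every colour sequence `κ : Fin k → Bool` and all
  `1 ≤ r ≤ R`, `0 < P_{1/2}(armEvent κ r R)`.**

This is the positivity input of every use of quasi-multiplicativity to change the inner radius
(`P(A(m,N)) ≤ P(A(n₀,N)) / (c · P(A(n₀,m)))`, Nolin §4.1: "for any fixed `n₁, n₂ ≥ n₀(j)`,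
`P̂(A_{j,σ}(n₁,N)) ≍ P̂(A_{j,σ}(n₂,N))`"), in particular for the five-arm events of
`Nolin2008_thm24_fiveArm_upper` / `Nolin2008_prop17_quasiMult` (`FiveArmExponentFacts.lean`); the
tree so far had the two-arm instance `polyArmProb_twoArm_pos` (`ArmEventsProofs.lean`) only.

Contents: `triRayDir` (the six unit vectors, anticlockwise from `e₀`), `triRaySeg d r R` (the ray
segment `{t • u_d : r ≤ t ≤ R}`), their coordinates / norms / adjacency / disjointness, the
inclusion of the cylinder event in the arm event (`mem_armEvent_of_rays`), and `polyArmProb_pos`.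

## References

* P. Nolin, Near-critical percolation in two dimensions, *Electron. J. Probab.* 13 (2008)
  1562–1623, §4.1 (the integer `n₀(j)`; `n₀(j) = 0` for `j ≤ 6`) (arXiv 0711.4948: p. 8)
  [Nolin2008].
* S. Smirnov, W. Werner, Critical exponents for two-dimensional percolation, *Math. Res. Lett.*
  8 (2001), §3 ("for all large enough `r`") [SmirnovWernerMRL2001].

## Mathlib / tree

Tree: `mem_armEvent_of_pathIn` (`ParaPivotalArms.lean`), `TwoArmPos.triSitePercolation_half_cylinder_pos`,
`polyArmProb_twoArm_pos` (`ArmEventsProofs.lean`), `triGraph_adj_iff_coord`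
(`TriAnnulusCircuit.lean`), `Site.eq_iff_two` (`PlanarDuality.lean`), `triNorm`, `triBall`,
`triSphere` (`TriangularLattice.lean`), `PathIn` (`SitePaths.lean`). Mathlib:
`MeasureTheory.measureReal_mono`, `Fin.castLE`.
-/

noncomputable section

open Set MeasureTheory

namespace Literature.Probability.Percolation

open LatticeModels

/-! ### The six lattice rays -/

/-- The six unit vectors of `𝕋` in anticlockwise order: `e₀ = (1,0)`, `e₁ = (0,1)`, `(-1,1)`,
`-e₀`, `-e₁`, `(1,-1)` (Grimmett 1999, §1.6, Fig. 1.7; Nolin 2008, §4.1: the directions of the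
"straight lines heading toward the exterior"). [cite: Nolin2008, §4.1 (n₀(j)) (arXiv 0711.4948: p. 8)] -/
def triRayDir : Fin 6 → Site 2 :=
  ![![1, 0], ![0, 1], ![-1, 1], ![-1, 0], ![0, -1], ![1, -1]]

/-- The ray segment `{t • u_d : r ≤ t ≤ R}` in the direction `u_d = triRayDir d`. [cite: Nolin2008, §4.1 (n₀(j)) (arXiv 0711.4948: p. 8)] -/
def triRaySeg (d : Fin 6) (r R : ℕ) : Set (Site 2) :=
  {v | ∃ t : ℕ, r ≤ t ∧ t ≤ R ∧ v = (t : ℤ) • triRayDir d}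

/-- First coordinates of the six unit vectors. [folklore] -/
theorem triRayDir_apply_zero (d : Fin 6) :
    triRayDir d 0 = (![1, 0, -1, -1, 0, 1] : Fin 6 → ℤ) d := by
  fin_cases d <;> rfl

/-- Second coordinates of the six unit vectors. [folklore] -/
theorem triRayDir_apply_one (d : Fin 6) :
    triRayDir d 1 = (![0, 1, 1, 0, -1, -1] : Fin 6 → ℤ) d := by
  fin_cases d <;> rfl

/-- Coordinates of a ray point. [folklore] -/
theorem smul_triRayDir_apply (t : ℤ) (d : Fin 6) (i : Fin 2) :
    (t • triRayDir d) i = t * triRayDir d i := by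
  simp [Pi.smul_apply]

/-- The graph norm of the ray point `t • u_d` is `|t|`. [folklore] -/
theorem triNorm_smul_triRayDir (t : ℤ) (d : Fin 6) : triNorm (t • triRayDir d) = |t| := by
  have h0 := smul_triRayDir_apply t d 0
  have h1 := smul_triRayDir_apply t d 1
  rw [triRayDir_apply_zero] at h0
  rw [triRayDir_apply_one] at h1
  unfold triNorm
  rw [h0, h1]
  fin_cases d <;> simp

/-- Consecutive ray points are adjacent in `𝕋`. [folklore] -/
theorem triGraph_adj_smul_triRayDir (t : ℤ) (d : Fin 6) :
    triGraph.Adj (t • triRayDir d) ((t + 1) • triRayDir d) := by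
  rw [triGraph_adj_iff_coord]
  simp only [smul_triRayDir_apply, triRayDir_apply_zero, triRayDir_apply_one]
  fin_cases d <;> simp

/-- Ray points with positive parameters determine the direction and the parameter. [folklore] -/
theorem smul_triRayDir_inj {t t' : ℤ} {d d' : Fin 6} (ht : 0 < t) (ht' : 0 < t')
    (h : t • triRayDir d = t' • triRayDir d') : d = d' ∧ t = t' := by
  have h0 := congrFun h 0
  have h1 := congrFun h 1
  simp only [smul_triRayDir_apply, triRayDir_apply_zero, triRayDir_apply_one] at h0 h1
  fin_cases d <;> fin_cases d' <;> simp at h0 h1 ⊢ <;> omega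

/-- A ray segment is a `𝕋`-path from its inner end to its outer end. [folklore] -/
theorem pathIn_triRaySeg (d : Fin 6) {r R : ℕ} (h : r ≤ R) :
    PathIn triGraph (triRaySeg d r R) ((r : ℤ) • triRayDir d) ((R : ℤ) • triRayDir d) := by
  induction R, h using Nat.le_induction with
  | base => exact PathIn.refl ⟨r, le_rfl, le_rfl, rfl⟩
  | succ R hrR ih =>
    have hmono : triRaySeg d r R ⊆ triRaySeg d r (R + 1) := by
      rintro v ⟨t, ht1, ht2, rfl⟩
      exact ⟨t, ht1, by omega, rfl⟩
    refine (ih.mono hmono).tail ?_ ⟨R + 1, by omega, le_rfl, rfl⟩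
    have := triGraph_adj_smul_triRayDir (R : ℤ) d
    push_cast
    exact this

/-- Distinct rays are disjoint away from the origin. [folklore] -/
theorem disjoint_triRaySeg {d d' : Fin 6} (hdd' : d ≠ d') {r R : ℕ} (hr : 1 ≤ r) :
    Disjoint (triRaySeg d r R) (triRaySeg d' r R) := by
  rw [Set.disjoint_left]
  rintro v ⟨t, ht1, -, rfl⟩ ⟨t', ht1', -, h⟩
  exact hdd' (smul_triRayDir_inj (by omega) (by omega) h).1

/-- The norm of a site of a ray segment lies between the two radii. [folklore] -/
theorem triNorm_mem_triRaySeg {d : Fin 6} {r R : ℕ} {v : Site 2} (hv : v ∈ triRaySeg d r R) :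
    (r : ℤ) ≤ triNorm v ∧ triNorm v ≤ R := by
  obtain ⟨t, ht1, ht2, rfl⟩ := hv
  rw [triNorm_smul_triRayDir, abs_of_nonneg (by positivity)]
  exact ⟨by exact_mod_cast ht1, by exact_mod_cast ht2⟩

/-! ### The arm event contains a cylinder event -/

/-- **Straight arms.** Let `k ≤ 6`, `κ : Fin k → Bool`, `1 ≤ r ≤ R`. A configuration in which,
for each `i < k`, every site of the `i`-th ray segment `{t • u_i : r ≤ t ≤ R}` has colour `κ i`
lies in `armEvent κ r R` (Nolin 2008, §4.1: "we can then draw straight lines heading toward the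
exterior", `n₀(j) = 0` for `j ≤ 6`). [cite: Nolin2008, §4.1 (n₀(j)) (arXiv 0711.4948: p. 8)] -/
theorem mem_armEvent_of_rays {k : ℕ} (hk : k ≤ 6) (κ : Fin k → Bool) {r R : ℕ} (hr : 1 ≤ r)
    (hrR : r ≤ R) {ω : SiteConfig (Site 2)}
    (hω : ∀ i : Fin k, ∀ v ∈ triRaySeg (Fin.castLE hk i) r R, (v ∈ ω ↔ κ i = true)) :
    ω ∈ armEvent κ r R := by
  refine mem_armEvent_of_pathIn κ (fun i => triRaySeg (Fin.castLE hk i) r R) ?_ hω ?_ ?_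
  · intro i j hij
    exact disjoint_triRaySeg (fun h => hij (Fin.castLE_injective hk h)) hr
  · intro i z hz
    exact triNorm_mem_triRaySeg hz
  · intro i
    refine ⟨(r : ℤ) • triRayDir (Fin.castLE hk i), ?_, (R : ℤ) • triRayDir (Fin.castLE hk i), ?_,
      pathIn_triRaySeg _ hrR⟩
    · rw [mem_triSphere_iff, triNorm_smul_triRayDir, abs_of_nonneg (by positivity)]
    · rw [mem_triSphere_iff, triNorm_smul_triRayDir, abs_of_nonneg (by positivity)]

/-- **Positivity of the arm probabilities** (Nolin 2008, §4.1: `n₀(j) = 0` for `j ≤ 6`, i.e.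
`A_{j,σ}(n,N) ≠ ∅` for all `N ≥ n`; here in probability form for `P_{1/2}` and the hexagonal
annuli of `armEvent`): for every `k ≤ 6`, every colour sequence `κ : Fin k → Bool` and all radii
`1 ≤ r ≤ R`, `0 < polyArmProb κ r R = P_{1/2}(armEvent κ r R)`. The arm event contains the
cylinder event "the sites of the `i`-th ray segment have colour `κ i`, `i < k`", of positive
probability (`TwoArmPos.triSitePercolation_half_cylinder_pos`). (`r ≥ 1` is needed as soon as `k ≥ 2`:
arms from `∂Λ_0 = {0}` would share the origin.) [cite: Nolin2008, §4.1 (n₀(j) = 0 for j ≤ 6) (arXiv 0711.4948: p. 8)] -/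
theorem polyArmProb_pos {k : ℕ} (hk : k ≤ 6) (κ : Fin k → Bool) {r R : ℕ} (hr : 1 ≤ r)
    (hrR : r ≤ R) : 0 < polyArmProb κ r R := by
  classical
  -- the cylinder event: on `Λ_R`, a site is open iff it lies on a ray of an open colour
  set b : Site 2 → Prop := fun v => ∃ i : Fin k, v ∈ triRaySeg (Fin.castLE hk i) r R ∧ κ i = true
    with hb
  have hsub : {ω : SiteConfig (Site 2) | ∀ v ∈ triBall R, (v ∈ ω ↔ b v)} ⊆ armEvent κ r R := by
    intro ω hω
    refine mem_armEvent_of_rays hk κ hr hrR fun i v hv => ?_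
    have hvR : v ∈ triBall R := by
      rw [mem_triBall_iff]
      exact (triNorm_mem_triRaySeg hv).2
    rw [hω v hvR, hb]
    constructor
    · rintro ⟨j, hj, hκj⟩
      have hij : i = j := by
        by_contra hne
        exact Set.disjoint_left.1
          (disjoint_triRaySeg (fun h => hne (Fin.castLE_injective hk h)) hr) hv hj
      rw [hij]; exact hκj
    · intro hκ
      exact ⟨i, hv, hκ⟩
  calc (0 : ℝ) < (triSitePercolation half).real {ω | ∀ v ∈ triBall R, (v ∈ ω ↔ b v)} :=
      TwoArmPos.triSitePercolation_half_cylinder_pos (triBall R) b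
    _ ≤ polyArmProb κ r R := measureReal_mono hsub

end Literature.Probability.Percolation
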